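import Literature.NumberTheory.Automorphic.SchurOrthogonalitySupercuspidal
import Literature.NumberTheory.Automorphic.SmoothCharacterFixedVectorBasis
import HarnessLib

/-!
# The character of a supercuspidal representation and its matrix coefficients

Topic `NumberTheory/Automorphic` (declarations in Mathlib's `Representation` namespace, as deliberate
dot-notation extensions of ★ `Representation.IsSupercuspidal`; theorems only — no definition,
instance, notation or named fact).

Frame (= that of the Schur orthogonality relations ★ `SchurOrthogonalitySupercuspidal`,
Harish-Chandra 1970, Part I §1, Theorem 1): `G` locally profinite with COMPACT centre,
`ρ : Representation ℂ G V` irreducible, admissible, supercuspidal, `B` a `G`-invariant positive-definite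
Hermitian form, `ν` an inversion-invariant Haar measure, `κ = (∫ ‖B (ρ x v₀) v₀‖² dν)/(re B v₀ v₀)² =
d(ρ)⁻¹` Schur's constant (any `v₀ ≠ 0`). Write `u_v(g) := B (ρ g v) v = conj (B v (ρ g v))` (a test
function, ★ `IsSupercuspidal.mem_schwartzBruhat_sesqForm_apply_self`) and `tr` for the character ★
`Representation.smoothTrace · ν` (Getz–Hahn 2024, (8.15)). The three facts that make
`f_v := d(ρ) (B v v)⁻¹ · u_v` the standard PSEUDO-COEFFICIENT candidate (Rogawski 1990, §12.6, p. 187: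
"`f_π` a matrix coefficient if `π` is supercuspidal"; Harish-Chandra 1970, Part III):

* `IsSupercuspidal.smoothTrace_sesqForm_apply_self` — **`tr ρ(u_v) = κ · B v v`**; normalised:
  `tr ρ(f_v) = 1`, `f_v(1) = d(ρ) > 0` (`…smoothTrace_inv_smul_sesqForm_apply_self`,
  `…inv_smul_sesqForm_apply_self_one`);
* `IsSupercuspidal.smoothTrace_sesqForm_apply_self_eq_zero_of_forall_intertwiningMap` —
  **`tr σ(u_v) = 0`** for every admissible `σ` with no non-zero intertwiner `σ → ρ` (`…_of_isEmpty` for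
  `σ` irreducible, `σ ≄ ρ`) — Theorem 1 (b) read through the trace;
* `IsSupercuspidal.integral_integral_mul_sesqForm_conj_eq` — **`tr ρ(φ)` as a double integral of ONE
  coefficient**: `∫_x ∫_g φ(g) · B v (ρ (x g x⁻¹) v) dν(g) dν(x) = κ · B v v · tr ρ(φ)` for every
  `φ ∈ C_c^∞(G)`, the `x`-integrand being `F(x⁻¹)` for a continuous integrable `F`
  (`…exists_continuous_integral_mul_sesqForm_conj_eq`, `…integrable_integral_mul_sesqForm_conj`) — the
  input of the elliptic reading `Φ(γ, u_v) = κ (B v v) conj χ_ρ(γ)` (Harish-Chandra 1970, Part III;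
  NOT in this file, nor is any orbital integral of `u_v` or anything about `G / Z`).

Proofs: finite-dimensional linear algebra on `V^K` (`K` a level) over ★ Schur (a)/(b) and the support
file ★ `SmoothCharacterFixedVectorBasis` — coordinate functionals `ℓᵢ = bᵢ* ∘ e_K` of a basis of
`V^K`, their Riesz vectors `ℓᵢ = B cᵢ` (★ `exists_sesqForm_apply_eq_of_mem_contragredient`),
`tr ρ(φ) = Σᵢ ∫ φ(g) ℓᵢ(ρ(g) bᵢ) dν`, `e_K w = Σᵢ ℓᵢ(w) bᵢ`, and each resulting scalar integral is a Schur
integral `∫ conj (B b (ρ x a)) · B e (ρ x c) dν = κ · B e b · B a c`. No vector-valued integral, no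
orthonormal basis, no Fubini.

## References

* Harish-Chandra (notes by G. van Dijk), *Harmonic analysis on reductive `p`-adic groups*, Lecture
  Notes in Math. 162 (1970), Part I §1 (Theorem 1), §3; Part III. [HarishChandra1970]
* J. D. Rogawski, *Automorphic representations of unitary groups in three variables*, Annals of
  Math. Studies 123 (1990), §12.6, pp. 187–188. [Rogawski1990]
* J. R. Getz, H. Hahn, *An introduction to automorphic representations* (2024), §8.5, (8.15). [GetzHahn2024]
-/

noncomputable section

open MeasureTheory
open scoped ComplexConjugate

namespace Representation

open Literature.NumberTheory.Automorphic Literature.NumberTheory.Automorphic.SmoothProjector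

/-! ### The traces of the diagonal coefficient `u_v(g) = B (ρ g v) v` of a supercuspidal `ρ` -/

section Supercuspidal

variable {G V : Type*} [Group G] [TopologicalSpace G] [NonarchimedeanGroup G]
  [LocallyCompactSpace G] [T2Space G] [MeasurableSpace G] [BorelSpace G]
  [AddCommGroup V] [Module ℂ V] {ρ : Representation ℂ G V} {B : V →ₗ⋆[ℂ] V →ₗ[ℂ] ℂ}

/-- **`tr ρ(u_v) = κ · B v v`.** For `ρ` irreducible, admissible and supercuspidal (compact centre),
`B` an invariant positive-definite Hermitian form, `ν` an inversion-invariant Haar measure and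
`u_v(g) = B (ρ g v) v`: `tr ρ(u_v) = κ · B v v` with `κ = (∫ ‖B (ρ x v₀) v₀‖² dν)/(re B v₀ v₀)² = d(ρ)⁻¹`
(any `v₀ ≠ 0`) — i.e. `tr ρ(u_v) = ‖v‖² / d(ρ)` (Rogawski 1990, §12.6 p. 187; Harish-Chandra 1970,
Part III). Proof: `tr ρ(u_v) = Σⱼ ∫ conj (B v (ρ g v)) · B cⱼ (ρ g bⱼ) = κ Σⱼ B cⱼ v · B v bⱼ = κ · B v (e_K v)
= κ · B v v` (Schur (a), `K ⊆ Stab(v)` a level). [cite: HarishChandra1970, Part I §1 Theorem 1 (a)] -/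
theorem IsSupercuspidal.smoothTrace_sesqForm_apply_self [ρ.IsIrreducible]
    (hadm : ρ.IsAdmissible) (hsc : ρ.IsSupercuspidal)
    (hZ : IsCompact (Subgroup.center G : Set G)) (hBsymm : B.IsSymm)
    (hBpos : ∀ v : V, v ≠ 0 → 0 < (B v v).re)
    (hBinv : ∀ (g : G) (v w : V), B (ρ g v) (ρ g w) = B v w) (ν : Measure G) [ν.IsHaarMeasure]
    [ν.IsInvInvariant] {v₀ : V} (hv₀ : v₀ ≠ 0) (v : V) :
    ρ.smoothTrace ν (fun g => B (ρ g v) v) =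
      (((∫ x, ‖B (ρ x v₀) v₀‖ ^ 2 ∂ν) / (B v₀ v₀).re ^ 2 : ℝ) : ℂ) * B v v := by
  have hsm := hadm.isSmooth
  have hBdef := eq_zero_of_sesqForm_self_eq_zero hBpos
  obtain ⟨K, hKv, hlev⟩ := exists_mem_fixedPoints_isLevel_sesqForm_apply_self hsm hBinv v
  have hcs : HasCompactSupport (fun g => B (ρ g v) v) :=
    hsc.hasCompactSupport_sesqForm_apply_apply' hZ hsm hBinv v v
  haveI : Module.Finite ℂ (ρ.fixedPoints K) :=
    hadm.finite_fixedPoints ⟨K, hlev.isOpen⟩ hlev.isCompact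
  set b := Module.finBasis ℂ (ρ.fixedPoints K)
  rw [smoothTrace_eq_sum_integral_mul_coord_levelOp ν hadm hcs hlev b]
  obtain ⟨ℓ, hℓmem, hℓop, -, hℓavg⟩ := exists_dual_coord_levelOp hsm hlev.isOpen hlev.isCompact b
  choose c hc using fun i =>
    exists_sesqForm_apply_eq_of_mem_contragredient hadm hBinv hBdef (hℓmem i)
  have hcw : ∀ i w, ℓ i w = B (c i) w := fun i w => by rw [hc]
  have hterm : ∀ i,
      ∫ g, B (ρ g v) v * b.coord i (ρ.levelOp hlev.isOpen hlev.isCompact g (b i)) ∂ν =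
        (((∫ x, ‖B (ρ x v₀) v₀‖ ^ 2 ∂ν) / (B v₀ v₀).re ^ 2 : ℝ) : ℂ) * (B (c i) v * B v (b i)) := by
    intro i
    rw [← hsc.integral_conj_matrixCoeff_mul_matrixCoeff_eq hadm hZ hBsymm hBpos hBinv ν hv₀ v v
      (b i : V) (c i)]
    refine integral_congr_ae (Filter.Eventually.of_forall fun g => ?_)
    simp only [hℓop, hcw, ← hBsymm.eq v (ρ g v)]
  rw [Finset.sum_congr rfl fun i _ => hterm i, ← Finset.mul_sum]
  congr 1
  calc ∑ i, B (c i) v * B v (b i : V) = B v (∑ i, ℓ i v • (b i : V)) := by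
        simp only [map_sum, map_smul, smul_eq_mul, hcw]
    _ = B v v := by rw [← hℓavg, avg_eq_self_of_mem_fixedPoints hKv]

/-- **`tr σ(u_v) = 0` for `σ` admitting no non-zero intertwiner to `ρ`.** With `ρ`, `B`, `ν`, `u_v`
as in `IsSupercuspidal.smoothTrace_sesqForm_apply_self` and `σ` ANY admissible representation on `W`
with `∀ T : σ.IntertwiningMap ρ, T = 0`: `tr σ(u_v) = 0` — through a basis `(bⱼ)` of `W^K`,
`tr σ(u_v) = Σⱼ ∫ conj (B v (ρ g v)) · mⱼ(σ g bⱼ) dν = 0` term by term by Schur orthogonality (b)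
("`tr σ(f_π) = 0` for `σ ≄ π`", Rogawski 1990, §12.6). [cite: HarishChandra1970, Part I §1 Theorem 1 (b)] -/
theorem IsSupercuspidal.smoothTrace_sesqForm_apply_self_eq_zero_of_forall_intertwiningMap
    [ρ.IsIrreducible] (hadm : ρ.IsAdmissible) (hsc : ρ.IsSupercuspidal)
    (hZ : IsCompact (Subgroup.center G : Set G)) (hBsymm : B.IsSymm)
    (hBpos : ∀ v : V, v ≠ 0 → 0 < (B v v).re)
    (hBinv : ∀ (g : G) (v w : V), B (ρ g v) (ρ g w) = B v w)
    {W : Type*} [AddCommGroup W] [Module ℂ W] {σ : Representation ℂ G W} (hσ : σ.IsAdmissible)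
    (h0 : ∀ T : σ.IntertwiningMap ρ, T = 0) (ν : Measure G) [ν.IsHaarMeasure]
    [ν.IsInvInvariant] (v : V) :
    σ.smoothTrace ν (fun g => B (ρ g v) v) = 0 := by
  have hsm := hadm.isSmooth
  obtain ⟨K, hKv, hlev⟩ := exists_mem_fixedPoints_isLevel_sesqForm_apply_self hsm hBinv v
  have hcs : HasCompactSupport (fun g => B (ρ g v) v) :=
    hsc.hasCompactSupport_sesqForm_apply_apply' hZ hsm hBinv v v
  haveI : Module.Finite ℂ (σ.fixedPoints K) :=
    hσ.finite_fixedPoints ⟨K, hlev.isOpen⟩ hlev.isCompact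
  set b := Module.finBasis ℂ (σ.fixedPoints K)
  rw [smoothTrace_eq_sum_integral_mul_coord_levelOp ν hσ hcs hlev b]
  obtain ⟨m, -, hmop, -, -⟩ := exists_dual_coord_levelOp hσ.isSmooth hlev.isOpen hlev.isCompact b
  refine Finset.sum_eq_zero fun i _ => ?_
  rw [← hsc.integral_conj_matrixCoeff_mul_matrixCoeff_eq_zero hadm hZ hBsymm hBpos hBinv
    hσ.isSmooth h0 ν (m i) (b i : W) v v]
  refine integral_congr_ae (Filter.Eventually.of_forall fun g => ?_)
  simp only [hmop, ← hBsymm.eq v (ρ g v)]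

/-- **`tr σ(u_v) = 0` for `σ` irreducible admissible and not isomorphic to `ρ`**
(`IsEmpty (σ.Equiv ρ)`; Schur: `Subsingleton (σ.IntertwiningMap ρ)`).
[cite: HarishChandra1970, Part I §1 Theorem 1 (b)] -/
theorem IsSupercuspidal.smoothTrace_sesqForm_apply_self_eq_zero_of_isEmpty
    [ρ.IsIrreducible] (hadm : ρ.IsAdmissible) (hsc : ρ.IsSupercuspidal)
    (hZ : IsCompact (Subgroup.center G : Set G)) (hBsymm : B.IsSymm)
    (hBpos : ∀ v : V, v ≠ 0 → 0 < (B v v).re)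
    (hBinv : ∀ (g : G) (v w : V), B (ρ g v) (ρ g w) = B v w)
    {W : Type*} [AddCommGroup W] [Module ℂ W] {σ : Representation ℂ G W} [σ.IsIrreducible]
    (hσ : σ.IsAdmissible) (hne : IsEmpty (σ.Equiv ρ)) (ν : Measure G) [ν.IsHaarMeasure]
    [ν.IsInvInvariant] (v : V) :
    σ.smoothTrace ν (fun g => B (ρ g v) v) = 0 :=
  haveI := hne
  hsc.smoothTrace_sesqForm_apply_self_eq_zero_of_forall_intertwiningMap hadm hZ hBsymm hBpos hBinv
    hσ (fun T => Subsingleton.elim T 0) ν v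

/-! #### The normalised coefficient `f_v = d(ρ) ‖v‖⁻² · u_v`: `tr ρ(f_v) = 1`, `tr σ(f_v) = 0`, `f_v(1) = d(ρ) > 0` -/

/-- **`tr ρ(f_v) = 1`** for the normalised diagonal coefficient
`f_v := ((∫ ‖B (ρ x v) v‖² dν) / re B v v)⁻¹ · u_v = d(ρ) ‖v‖⁻² u_v` (`v ≠ 0`; Rogawski 1990, §12.6;
`…smoothTrace_sesqForm_apply_self` at `v₀ = v` + ★ `smoothTrace_smul`). [cite: HarishChandra1970, Part I §1 Theorem 1 (a)] -/
theorem IsSupercuspidal.smoothTrace_inv_smul_sesqForm_apply_self [ρ.IsIrreducible]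
    (hadm : ρ.IsAdmissible) (hsc : ρ.IsSupercuspidal)
    (hZ : IsCompact (Subgroup.center G : Set G)) (hBsymm : B.IsSymm)
    (hBpos : ∀ v : V, v ≠ 0 → 0 < (B v v).re)
    (hBinv : ∀ (g : G) (v w : V), B (ρ g v) (ρ g w) = B v w) (ν : Measure G) [ν.IsHaarMeasure]
    [ν.IsInvInvariant] {v : V} (hv : v ≠ 0) :
    ρ.smoothTrace ν ((((∫ x, ‖B (ρ x v) v‖ ^ 2 ∂ν) / (B v v).re : ℝ) : ℂ)⁻¹ •
      fun g => B (ρ g v) v) = 1 := by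
  have hsm := hadm.isSmooth
  obtain ⟨K, hKv, hlev⟩ := exists_mem_fixedPoints_isLevel_sesqForm_apply_self hsm hBinv v
  have hcs : HasCompactSupport (fun g => B (ρ g v) v) :=
    hsc.hasCompactSupport_sesqForm_apply_apply' hZ hsm hBinv v v
  rw [ρ.smoothTrace_smul ν hadm _ hcs hlev,
    hsc.smoothTrace_sesqForm_apply_self hadm hZ hBsymm hBpos hBinv ν hv v]
  set r : ℝ := (B v v).re with hr
  have hβ : (B v v : ℂ) = (r : ℂ) := (Complex.conj_eq_iff_re.1 (hBsymm.eq v v)).symm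
  have hr0 : (r : ℂ) ≠ 0 := by exact_mod_cast (hBpos v hv).ne'
  have hI0 : ((∫ x, ‖B (ρ x v) v‖ ^ 2 ∂ν : ℝ) : ℂ) ≠ 0 := by
    exact_mod_cast (hsc.integral_norm_sq_sesqForm_pos hZ hsm hBsymm hBpos hBinv ν hv).ne'
  rw [hβ]
  push_cast
  field_simp

/-- **`tr σ(f_v) = 0`** for the normalised coefficient `f_v` of `ρ` and any admissible `σ` with no
non-zero intertwiner `σ → ρ`. [cite: HarishChandra1970, Part I §1 Theorem 1 (b)] -/
theorem IsSupercuspidal.smoothTrace_inv_smul_sesqForm_apply_self_eq_zero_of_forall_intertwiningMap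
    [ρ.IsIrreducible] (hadm : ρ.IsAdmissible) (hsc : ρ.IsSupercuspidal)
    (hZ : IsCompact (Subgroup.center G : Set G)) (hBsymm : B.IsSymm)
    (hBpos : ∀ v : V, v ≠ 0 → 0 < (B v v).re)
    (hBinv : ∀ (g : G) (v w : V), B (ρ g v) (ρ g w) = B v w)
    {W : Type*} [AddCommGroup W] [Module ℂ W] {σ : Representation ℂ G W} (hσ : σ.IsAdmissible)
    (h0 : ∀ T : σ.IntertwiningMap ρ, T = 0) (ν : Measure G) [ν.IsHaarMeasure]
    [ν.IsInvInvariant] (v : V) :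
    σ.smoothTrace ν ((((∫ x, ‖B (ρ x v) v‖ ^ 2 ∂ν) / (B v v).re : ℝ) : ℂ)⁻¹ •
      fun g => B (ρ g v) v) = 0 := by
  have hsm := hadm.isSmooth
  obtain ⟨K, hKv, hlev⟩ := exists_mem_fixedPoints_isLevel_sesqForm_apply_self hsm hBinv v
  have hcs : HasCompactSupport (fun g => B (ρ g v) v) :=
    hsc.hasCompactSupport_sesqForm_apply_apply' hZ hsm hBinv v v
  rw [σ.smoothTrace_smul ν hσ _ hcs hlev,
    hsc.smoothTrace_sesqForm_apply_self_eq_zero_of_forall_intertwiningMap hadm hZ hBsymm hBpos hBinv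
      hσ h0 ν v, mul_zero]

omit [LocallyCompactSpace G] [T2Space G] in
/-- **`f_v(1) = d(ρ) > 0`**: the value at `1` of the normalised coefficient `f_v` is the positive real
`(re B v v)² / ∫ ‖B (ρ x v) v‖² dν`, the formal degree of `ρ` relative to `ν` (Harish-Chandra 1970,
Part I §1, "`d(π) > 0`"; the POS-ONE property of a pseudo-coefficient).
[cite: HarishChandra1970, Part I §1 Theorem 1 (a)] -/
theorem IsSupercuspidal.inv_smul_sesqForm_apply_self_one
    (hsc : ρ.IsSupercuspidal) (hZ : IsCompact (Subgroup.center G : Set G)) (hsm : ρ.IsSmooth)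
    (hBsymm : B.IsSymm) (hBpos : ∀ v : V, v ≠ 0 → 0 < (B v v).re)
    (hBinv : ∀ (g : G) (v w : V), B (ρ g v) (ρ g w) = B v w) (ν : Measure G) [ν.IsHaarMeasure]
    {v : V} (hv : v ≠ 0) :
    ((((∫ x, ‖B (ρ x v) v‖ ^ 2 ∂ν) / (B v v).re : ℝ) : ℂ)⁻¹ • fun g => B (ρ g v) v) 1 =
        (((B v v).re ^ 2 / ∫ x, ‖B (ρ x v) v‖ ^ 2 ∂ν : ℝ) : ℂ) ∧
      0 < (B v v).re ^ 2 / ∫ x, ‖B (ρ x v) v‖ ^ 2 ∂ν := by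
  have hI : 0 < ∫ x, ‖B (ρ x v) v‖ ^ 2 ∂ν :=
    hsc.integral_norm_sq_sesqForm_pos hZ hsm hBsymm hBpos hBinv ν hv
  refine ⟨?_, div_pos (pow_pos (hBpos v hv) 2) hI⟩
  simp only [Pi.smul_apply, smul_eq_mul, map_one, Module.End.one_apply]
  set r : ℝ := (B v v).re with hr
  have hβ : (B v v : ℂ) = (r : ℂ) := (Complex.conj_eq_iff_re.1 (hBsymm.eq v v)).symm
  have hr0 : (r : ℂ) ≠ 0 := by exact_mod_cast (hBpos v hv).ne'
  have hI0 : ((∫ x, ‖B (ρ x v) v‖ ^ 2 ∂ν : ℝ) : ℂ) ≠ 0 := by exact_mod_cast hI.ne'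
  rw [hβ]
  push_cast
  field_simp

/-! ### The trace of any test function as a double integral of one matrix coefficient -/

/-- **The trace against one coefficient, packaged.** For `ρ` irreducible, admissible and
supercuspidal (compact centre), `B` an invariant positive-definite Hermitian form, `ν` an
inversion-invariant Haar measure, `φ ∈ C_c^∞(G)` and `v ∈ V` there is a CONTINUOUS INTEGRABLE
`F : G → ℂ` (a finite sum of products of two matrix coefficients of `ρ`) with
`∫ φ(g) · B v (ρ (x g x⁻¹) v) dν(g) = F(x⁻¹)` for every `x`, and
`∫ F dν = κ · B v v · tr ρ(φ)`, `κ = (∫ ‖B (ρ x v₀) v₀‖² dν)/(re B v₀ v₀)² = d(ρ)⁻¹` (any `v₀ ≠ 0`).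
Proof: with `w = ρ(x⁻¹) v` the inner integral is `Σᵢⱼ conj ℓᵢ(w) ℓⱼ(w) B bᵢ (ρ(φ) bⱼ)`; Schur (a) in
`x` gives `κ B cⱼ cᵢ · B v v`, and `Σᵢ B cⱼ cᵢ · B bᵢ (ρ(φ) bⱼ) = bⱼ*(ρ(φ) bⱼ)` sums to `tr ρ(φ)`
(Harish-Chandra 1970, Part III). [cite: HarishChandra1970, Part I §1 Theorem 1 (a)] -/
theorem IsSupercuspidal.exists_continuous_integral_mul_sesqForm_conj_eq [ρ.IsIrreducible]
    (hadm : ρ.IsAdmissible) (hsc : ρ.IsSupercuspidal)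
    (hZ : IsCompact (Subgroup.center G : Set G)) (hBsymm : B.IsSymm)
    (hBpos : ∀ v : V, v ≠ 0 → 0 < (B v v).re)
    (hBinv : ∀ (g : G) (v w : V), B (ρ g v) (ρ g w) = B v w) (ν : Measure G) [ν.IsHaarMeasure]
    [ν.IsInvInvariant] {φ : G → ℂ} (hφ : φ ∈ SchwartzBruhat G) {v₀ : V} (hv₀ : v₀ ≠ 0) (v : V) :
    ∃ F : G → ℂ, Continuous F ∧ Integrable F ν ∧
      (∀ x, ∫ g, φ g * B v (ρ (x * g * x⁻¹) v) ∂ν = F x⁻¹) ∧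
      ∫ x, F x ∂ν =
        (((∫ x, ‖B (ρ x v₀) v₀‖ ^ 2 ∂ν) / (B v₀ v₀).re ^ 2 : ℝ) : ℂ) * B v v *
          ρ.smoothTrace ν φ := by
  have hsm := hadm.isSmooth
  have hBdef := eq_zero_of_sesqForm_self_eq_zero hBpos
  haveI : ν.IsMulRightInvariant := by
    have h := Measure.inv.instIsMulRightInvariant (μ := ν)
    rwa [Measure.inv_eq_self] at h
  obtain ⟨K, hK⟩ := exists_isLevel hφ
  have hφc : HasCompactSupport φ := hφ.2
  haveI : Module.Finite ℂ (ρ.fixedPoints K) := hadm.finite_fixedPoints ⟨K, hK.isOpen⟩ hK.isCompact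
  set b := Module.finBasis ℂ (ρ.fixedPoints K)
  obtain ⟨ℓ, hℓmem, hℓop, hℓfix, hℓavg⟩ := exists_dual_coord_levelOp hsm hK.isOpen hK.isCompact b
  choose c hc using fun i =>
    exists_sesqForm_apply_eq_of_mem_contragredient hadm hBinv hBdef (hℓmem i)
  have hcw : ∀ i w, ℓ i w = B (c i) w := fun i w => by rw [hc]
  -- abbreviations: Schur's constant `κ`, the vectors `u j = ρ(φ) b_j ∈ V^K`
  set κ : ℂ := (((∫ x, ‖B (ρ x v₀) v₀‖ ^ 2 ∂ν) / (B v₀ v₀).re ^ 2 : ℝ) : ℂ) with hκ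
  set u : Fin (Module.finrank ℂ (ρ.fixedPoints K)) → V := fun j => ρ.levelAct ν K φ (b j : V)
    with hudef
  have huK : ∀ j, u j ∈ ρ.fixedPoints K := fun j =>
    ρ.levelAct_mem_fixedPoints ν hK.isOpen hK.isCompact hφc hK.mul_right hK.mul_left (b j).2
  set F : G → ℂ := fun y =>
    ∑ i, ∑ j, conj (B (c i) (ρ y v)) * B (c j) (ρ y v) * B (b i : V) (u j) with hFdef
  have hintij : ∀ i j, Integrable (fun y => conj (B (c i) (ρ y v)) * B (c j) (ρ y v) *
      B (b i : V) (u j)) ν := fun i j =>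
    (((Complex.continuous_conj.comp (continuous_sesqForm_apply_apply (hsm v) (c i))).mul
      (continuous_sesqForm_apply_apply (hsm v) (c j))).mul continuous_const).integrable_of_hasCompactSupport
      ((hsc.hasCompactSupport_sesqForm_apply_apply hZ hsm hBinv v (c j)).mul_left.mul_right)
  refine ⟨F, ?_, integrable_finsetSum _ fun i _ => integrable_finsetSum _ fun j _ => hintij i j,
    fun x => ?_, ?_⟩
  · -- continuity
    exact continuous_finsetSum _ fun i _ => continuous_finsetSum _ fun j _ =>
      ((Complex.continuous_conj.comp (continuous_sesqForm_apply_apply (hsm v) (c i))).mul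
        (continuous_sesqForm_apply_apply (hsm v) (c j))).mul continuous_const
  · -- (1) the inner integral at `x` is `F x⁻¹`
    have hws : ρ.IsSmoothVector (ρ x⁻¹ v) := (hsm v).apply ρ x⁻¹
    have h1 : ∀ g, B v (ρ (x * g * x⁻¹) v) = B (ρ x⁻¹ v) (ρ g (ρ x⁻¹ v)) := fun g => by
      rw [← hBinv x⁻¹ v (ρ (x * g * x⁻¹) v)]
      simp only [map_mul, Module.End.mul_apply, inv_self_apply]
    simp_rw [h1]
    rw [← integral_mul_apply_apply_avg_eq ν hφc hK (B (ρ x⁻¹ v)) hws, hℓavg (ρ x⁻¹ v)]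
    simp only [map_sum, map_smul, smul_eq_mul, Finset.mul_sum]
    have hint : ∀ j,
        Integrable (fun g => φ g * (ℓ j (ρ x⁻¹ v) * B (ρ x⁻¹ v) (ρ g (b j : V)))) ν :=
      fun j => ((hK.isLocallyConstant.continuous.mul (continuous_const.mul
        (ρ.continuous_matrixCoeff (B (ρ x⁻¹ v))
          (ρ.isSmoothVector_of_mem_fixedPoints hK.isOpen (b j).2))))).integrable_of_hasCompactSupport
        hφc.mul_right
    rw [integral_finsetSum _ fun j _ => hint j]
    have h2 : ∀ j, ∫ g, φ g * (ℓ j (ρ x⁻¹ v) * B (ρ x⁻¹ v) (ρ g (b j : V))) ∂ν =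
        ℓ j (ρ x⁻¹ v) * B (ρ x⁻¹ v) (u j) := by
      intro j
      rw [hudef]
      simp only
      rw [ρ.apply_levelAct_eq_integral ν hK.isOpen hK.isCompact hφc hK.mul_right (b j).2
        (B (ρ x⁻¹ v)), ← integral_const_mul]
      refine integral_congr_ae (Filter.Eventually.of_forall fun g => ?_)
      simp only
      ring
    simp_rw [h2]
    have h3 : ∀ j, B (ρ x⁻¹ v) (u j) = ∑ i, conj (ℓ i (ρ x⁻¹ v)) * B (b i : V) (u j) := by
      intro j
      rw [← sesqForm_avg_apply_eq_of_mem_fixedPoints hBinv hK.isCompact hws (huK j),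
        hℓavg (ρ x⁻¹ v)]
      simp only [map_sum, LinearMap.map_smulₛₗ, LinearMap.sum_apply, LinearMap.smul_apply,
        smul_eq_mul]
    simp_rw [h3, hFdef, hcw, Finset.mul_sum]
    rw [Finset.sum_comm]
    refine Finset.sum_congr rfl fun i _ => Finset.sum_congr rfl fun j _ => ?_
    ring
  · -- (2) `∫ F dν`: Schur orthogonality term by term, then the trace through the basis
    rw [hFdef, integral_finsetSum _ fun i _ => integrable_finsetSum _ fun j _ => hintij i j]
    simp_rw [integral_finsetSum _ fun j _ => hintij _ j, integral_mul_const,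
      hsc.integral_conj_matrixCoeff_mul_matrixCoeff_eq hadm hZ hBsymm hBpos hBinv ν hv₀ v (c _) v
        (c _)]
    rw [smoothTrace_eq_sum_coord_levelActOp ν hadm hφc hK b]
    have htr : ∀ j, b.coord j (ρ.levelActOp ν hφc hK (b j)) =
        ∑ i, B (c j) (c i) * B (b i : V) (u j) := by
      intro j
      rw [← hℓfix, coe_levelActOp_apply, hcw]
      change B (c j) (u j) = _
      rw [← sesqForm_avg_apply_eq_of_mem_fixedPoints hBinv hK.isCompact (hsm (c j)) (huK j),
        hℓavg (c j)]
      simp only [map_sum, LinearMap.map_smulₛₗ, LinearMap.sum_apply, LinearMap.smul_apply,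
        smul_eq_mul, hcw]
      refine Finset.sum_congr rfl fun i _ => ?_
      rw [starRingEnd_apply, ← starRingEnd_apply, hBsymm.eq]
    simp_rw [htr, Finset.mul_sum]
    rw [Finset.sum_comm]
    refine Finset.sum_congr rfl fun i _ => Finset.sum_congr rfl fun j _ => ?_
    rw [← hκ]
    ring

/-- **`∫_x ∫_g φ(g) · B v (ρ (x g x⁻¹) v) dν(g) dν(x) = κ · B v v · tr ρ(φ)`** — the character of an
irreducible admissible supercuspidal `ρ` (compact centre) at ANY test function `φ ∈ C_c^∞(G)` as the
double integral of `φ` against the conjugates of ONE diagonal matrix coefficient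
`u_v(y) = B (ρ y v) v` (`B v (ρ y v) = conj u_v(y)`), `κ = d(ρ)⁻¹` Schur's constant
(`(∫ ‖B (ρ x v₀) v₀‖² dν)/(re B v₀ v₀)²`, any `v₀ ≠ 0`); equivalently
`tr ρ(φ) = d(ρ) ‖v‖⁻² ∫_x ∫_g φ(g) conj u_v(x g x⁻¹)` for `v ≠ 0`. The `x`-integrand is integrable
(`…integrable_integral_mul_sesqForm_conj`). (Harish-Chandra 1970, Part III; Rogawski 1990, §12.6.)
[cite: HarishChandra1970, Part I §1 Theorem 1 (a)] -/
theorem IsSupercuspidal.integral_integral_mul_sesqForm_conj_eq [ρ.IsIrreducible]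
    (hadm : ρ.IsAdmissible) (hsc : ρ.IsSupercuspidal)
    (hZ : IsCompact (Subgroup.center G : Set G)) (hBsymm : B.IsSymm)
    (hBpos : ∀ v : V, v ≠ 0 → 0 < (B v v).re)
    (hBinv : ∀ (g : G) (v w : V), B (ρ g v) (ρ g w) = B v w) (ν : Measure G) [ν.IsHaarMeasure]
    [ν.IsInvInvariant] {φ : G → ℂ} (hφ : φ ∈ SchwartzBruhat G) {v₀ : V} (hv₀ : v₀ ≠ 0) (v : V) :
    ∫ x, (∫ g, φ g * B v (ρ (x * g * x⁻¹) v) ∂ν) ∂ν =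
      (((∫ x, ‖B (ρ x v₀) v₀‖ ^ 2 ∂ν) / (B v₀ v₀).re ^ 2 : ℝ) : ℂ) * B v v *
        ρ.smoothTrace ν φ := by
  obtain ⟨F, -, -, hF, hint⟩ :=
    hsc.exists_continuous_integral_mul_sesqForm_conj_eq hadm hZ hBsymm hBpos hBinv ν hφ hv₀ v
  rw [show (fun x => ∫ g, φ g * B v (ρ (x * g * x⁻¹) v) ∂ν) = fun x => F x⁻¹ from funext hF,
    integral_inv_eq_self F ν, hint]

/-- The `x`-integrand `x ↦ ∫_g φ(g) · B v (ρ (x g x⁻¹) v) dν(g)` of `…integral_integral_mul_sesqForm_conj_eq`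
is integrable (`= F(x⁻¹)`, `F` integrable, `ν` inversion invariant). [cite: HarishChandra1970, Part I §1 Theorem 1 (a)] -/
theorem IsSupercuspidal.integrable_integral_mul_sesqForm_conj [ρ.IsIrreducible]
    (hadm : ρ.IsAdmissible) (hsc : ρ.IsSupercuspidal)
    (hZ : IsCompact (Subgroup.center G : Set G)) (hBsymm : B.IsSymm)
    (hBpos : ∀ v : V, v ≠ 0 → 0 < (B v v).re)
    (hBinv : ∀ (g : G) (v w : V), B (ρ g v) (ρ g w) = B v w) (ν : Measure G) [ν.IsHaarMeasure]
    [ν.IsInvInvariant] {φ : G → ℂ} (hφ : φ ∈ SchwartzBruhat G) (v : V) :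
    Integrable (fun x => ∫ g, φ g * B v (ρ (x * g * x⁻¹) v) ∂ν) ν := by
  haveI : Nontrivial V := IsIrreducible.nontrivial ρ
  obtain ⟨v₀, hv₀⟩ := exists_ne (0 : V)
  obtain ⟨F, -, hFint, hF, -⟩ :=
    hsc.exists_continuous_integral_mul_sesqForm_conj_eq hadm hZ hBsymm hBpos hBinv ν hφ hv₀ v
  rw [show (fun x => ∫ g, φ g * B v (ρ (x * g * x⁻¹) v) ∂ν) = fun x => F x⁻¹ from funext hF]
  exact hFint.comp_inv

/-- The same identity with the conjugation written `x⁻¹ g x`: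
`∫_x ∫_g φ(g) · B v (ρ (x⁻¹ g x) v) dν(g) dν(x) = κ · B v v · tr ρ(φ)`. [cite: HarishChandra1970, Part I §1 Theorem 1 (a)] -/
theorem IsSupercuspidal.integral_integral_mul_sesqForm_conj_eq' [ρ.IsIrreducible]
    (hadm : ρ.IsAdmissible) (hsc : ρ.IsSupercuspidal)
    (hZ : IsCompact (Subgroup.center G : Set G)) (hBsymm : B.IsSymm)
    (hBpos : ∀ v : V, v ≠ 0 → 0 < (B v v).re)
    (hBinv : ∀ (g : G) (v w : V), B (ρ g v) (ρ g w) = B v w) (ν : Measure G) [ν.IsHaarMeasure]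
    [ν.IsInvInvariant] {φ : G → ℂ} (hφ : φ ∈ SchwartzBruhat G) {v₀ : V} (hv₀ : v₀ ≠ 0) (v : V) :
    ∫ x, (∫ g, φ g * B v (ρ (x⁻¹ * g * x) v) ∂ν) ∂ν =
      (((∫ x, ‖B (ρ x v₀) v₀‖ ^ 2 ∂ν) / (B v₀ v₀).re ^ 2 : ℝ) : ℂ) * B v v *
        ρ.smoothTrace ν φ := by
  obtain ⟨F, -, -, hF, hint⟩ :=
    hsc.exists_continuous_integral_mul_sesqForm_conj_eq hadm hZ hBsymm hBpos hBinv ν hφ hv₀ v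
  have hF' : (fun x => ∫ g, φ g * B v (ρ (x⁻¹ * g * x) v) ∂ν) = F := by
    funext x
    have h := hF x⁻¹
    simp only [inv_inv] at h
    exact h
  rw [hF', hint]

end Supercuspidal

end Representation
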